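import Literature.Probability.RandomPlanarGeometry.HexSAW
import HarnessLib

/-!
# Restriction covariance of the SAW law of an embedded graph (and of the hexagonal lattice)

Topic `Literature/Probability/RandomPlanarGeometry` (companion to `HexSAW.lean`; the `δℤ²` version,
for `SAW.law`, is `SAWRestrictionCovariance.lean`).  The two-point SAW measure at fugacity `x`,
`P_{x,δ}(γ) ∝ x^{ℓ(γ)}` on the self-avoiding walks of the discrete domain `Ω_δ ⊆ δ·emb(G)` from
`a` to `b` of a graph `G` embedded in the plane by `emb` (`SAW.embLaw G emb Ω δ x a b`; for the
honeycomb lattice at `x = x_c = 1/√(2+√2)` this is Duminil-Copin–Smirnov's `P_{x_c,δ}`,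
`SAW.hexSAWLaw Ω δ a b`) is CONFIGURATIONAL, so for nested discrete domains it satisfies the exact
restriction property of Lawler–Schramm–Werner (the discrete counterpart of the restriction
covariance of `SLE_{8/3}`): conditioning the walk of the big domain `Ω_δ` to be a walk of the
small domain `Ω'_δ` gives the walk of `Ω'_δ`.  We record it in the inequality form consumed by
transfer arguments, for every set `E` of curve classes (the observable `γ.curve` of `HexSAW.lean`):

  `embLaw Ω' {curve ∈ E} · embLaw Ω {γ is (the support of) an Ω'_δ-walk} ≤ embLaw Ω {curve ∈ E}`
  (`embLaw_mul_embLaw_setOf_exists_support_eq_le`; hexagonal lattice: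
  `hexSAWLaw_mul_hexSAWLaw_setOf_exists_support_eq_le`),

valid whenever every `Ω'_δ`-walk `a → b` is, with the same support, an `Ω_δ`-walk ("nesting";
all junk cases — zero or infinite total weight, negative fugacity — included, the left side being
`0` there), likewise for sets of parametrised polylines (`embLaw_mul_embLaw_setOf_toCurve_mem_le`),
and more generally for any two events `S'` of `Ω'_δ` and `S` of `Ω_δ` such that every `S'`-walk is,
with the same support, an `S`-walk (`embLaw_mul_embLaw_le_of_forall_exists_support_eq`).
Proof: with `Z = embWeight Ω univ`, `Z' = embWeight Ω' univ`, the confinement event of `Ω_δ`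
weighs at most `Z'` (each confined `Ω`-walk comes from a unique `Ω'`-walk of the same weight,
`embWeight_setOf_exists_support_eq_le`) and `W'(E) ≤ W(E)` under nesting (each `Ω'`-walk is an
`Ω`-walk of the same weight and the same polyline, `embWeight_setOf_curve_mem_le`; both are the
support-preserving-injection bound `embWeight_le_embWeight_of_forall_exists_support_eq`), so
`Z'⁻¹ W'(E) · Z⁻¹ W(Conf) ≤ (Z'⁻¹ Z') · Z⁻¹ W'(E) ≤ Z⁻¹ W(E)`.

Also: the weight of a set as a sum (`embWeight_apply_eq_tsum_indicator`), the law as normalised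
weight (`embLaw_apply_eq_inv_mul_embWeight`), that a SAW of `Ω_δ` is determined by its support,
which also determines its length, vertex count, polyline and curve class
(`EmbDomainSAW.ext_support`, `EmbDomainSAW.length_eq_of_support_eq`,
`EmbDomainSAW.vertexCount_eq_of_support_eq`, `EmbDomainSAW.toCurve_eq_of_support_eq`,
`EmbDomainSAW.curve_eq_of_support_eq`), and the exact identity "confinement probability = ratio
of partition functions" (`embWeight_setOf_exists_support_eq_eq`, `embLaw_setOf_exists_support_eq_eq`,
`le_embLaw_setOf_exists_support_eq_iff`; hexagonal lattice: `hexSAWLaw_setOf_exists_support_eq_eq`).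

References: G. F. Lawler, O. Schramm, W. Werner, *On the scaling limit of planar self-avoiding
walk* (2004), §3 (the restriction property of the SAW measures); H. Duminil-Copin, S. Smirnov,
*The connective constant of the honeycomb lattice equals `√(2+√2)`*, Ann. of Math. 175 (2012), §4
(the law `P_{x,δ}`); folklore for the lattice identity itself.  Mathlib anchors:
`SimpleGraph.Walk.support_injective`, `ENNReal.tsum_comp_le_tsum_of_injective`,
`ENNReal.inv_mul_le_one`, `Measure.sum_apply`.
-/

noncomputable section

open _root_.MeasureTheory _root_.Set
open scoped ENNReal
open Literature.Probability.LatticeModels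

namespace Literature.Probability.RandomPlanarGeometry.SAW

section Embedded

variable {V : Type*} {G : SimpleGraph V} {emb : V → ℂ} {Ω' Ω : Set ℂ} {δ x : ℝ} {a b : V}

/-- The weight of a set of SAWs is the sum of the weights `x^{ℓ(γ)}` of its members. [folklore] -/
theorem embWeight_apply_eq_tsum_indicator (x : ℝ) (S : Set (EmbDomainSAW G emb Ω δ a b)) :
    embWeight G emb Ω δ x a b S =
      ∑' γ, S.indicator (fun γ => ENNReal.ofReal (x ^ γ.vertexCount)) γ := by
  rw [embWeight, Measure.sum_apply _ MeasurableSpace.measurableSet_top]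
  refine tsum_congr fun γ => ?_
  rw [Measure.smul_apply, Measure.dirac_apply' _ MeasurableSpace.measurableSet_top, smul_eq_mul]
  by_cases h : γ ∈ S <;> simp [h]

/-- The law is the normalised weight: `embLaw S = (embWeight univ)⁻¹ · embWeight S`. [folklore] -/
theorem embLaw_apply_eq_inv_mul_embWeight (x : ℝ) (S : Set (EmbDomainSAW G emb Ω δ a b)) :
    embLaw G emb Ω δ x a b S = (embWeight G emb Ω δ x a b Set.univ)⁻¹ * embWeight G emb Ω δ x a b S := by
  rw [embLaw, Measure.smul_apply, smul_eq_mul]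

/-- A SAW of `Ω_δ` is determined by its support (the list of its vertices). [folklore] -/
theorem EmbDomainSAW.ext_support {γ₁ γ₂ : EmbDomainSAW G emb Ω δ a b}
    (h : γ₁.walk.support = γ₂.walk.support) : γ₁ = γ₂ := by
  obtain ⟨p, hp⟩ := γ₁
  obtain ⟨q, hq⟩ := γ₂
  have hpq : p = q := SimpleGraph.Walk.support_injective h
  subst hpq
  rfl

/-- Walks with the same support (possibly in different discrete domains) have the same length.
[folklore] -/
theorem EmbDomainSAW.length_eq_of_support_eq {γ' : EmbDomainSAW G emb Ω' δ a b}
    {γ : EmbDomainSAW G emb Ω δ a b} (h : γ.walk.support = γ'.walk.support) :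
    γ.length = γ'.length := by
  have h1 := congrArg List.length h
  rw [SimpleGraph.Walk.length_support, SimpleGraph.Walk.length_support] at h1
  show γ.walk.length = γ'.walk.length
  omega

/-- Walks with the same support (possibly in different discrete domains) visit the same number of
vertices `ℓ(γ)`, hence have the same weight `x^{ℓ(γ)}`. [folklore] -/
theorem EmbDomainSAW.vertexCount_eq_of_support_eq {γ' : EmbDomainSAW G emb Ω' δ a b}
    {γ : EmbDomainSAW G emb Ω δ a b} (h : γ.walk.support = γ'.walk.support) :
    γ.vertexCount = γ'.vertexCount := by
  rw [EmbDomainSAW.vertexCount, EmbDomainSAW.vertexCount, EmbDomainSAW.length_eq_of_support_eq h]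

/-- Walks with the same support trace the same polyline (`SimpleGraph.Walk.toCurve` depends on
the support only). [folklore] -/
theorem EmbDomainSAW.toCurve_eq_of_support_eq {γ' : EmbDomainSAW G emb Ω' δ a b}
    {γ : EmbDomainSAW G emb Ω δ a b} (h : γ.walk.support = γ'.walk.support) :
    (⟨γ.walk.toCurve fun v => (δ : ℂ) * emb v⟩ : Curve ℂ) =
      ⟨γ'.walk.toCurve fun v => (δ : ℂ) * emb v⟩ := by
  simp only [SimpleGraph.Walk.toCurve, h]

/-- Walks with the same support give the same point `γ.curve` of the curve space (the polyline
modulo reparametrisation). [folklore] -/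
theorem EmbDomainSAW.curve_eq_of_support_eq {γ' : EmbDomainSAW G emb Ω' δ a b}
    {γ : EmbDomainSAW G emb Ω δ a b} (h : γ.walk.support = γ'.walk.support) :
    γ.curve = γ'.curve := by
  rw [EmbDomainSAW.curve, EmbDomainSAW.curve, EmbDomainSAW.toCurve_eq_of_support_eq h]

/-- **Support-preserving injections do not decrease the weight**: if every walk of the event `S'`
of `Ω'_δ` is, with the same support, a walk of the event `S` of `Ω_δ`, then
`embWeight Ω' S' ≤ embWeight Ω S` (the map `γ' ↦ its Ω-copy` is injective, `S' → S`, and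
weight-preserving). [folklore] -/
theorem embWeight_le_embWeight_of_forall_exists_support_eq {S' : Set (EmbDomainSAW G emb Ω' δ a b)}
    {S : Set (EmbDomainSAW G emb Ω δ a b)}
    (h : ∀ γ' ∈ S', ∃ γ ∈ S, γ.walk.support = γ'.walk.support) :
    embWeight G emb Ω' δ x a b S' ≤ embWeight G emb Ω δ x a b S := by
  classical
  rw [embWeight_apply_eq_tsum_indicator, embWeight_apply_eq_tsum_indicator]
  -- restrict the first sum to `S'`
  have hS' : ∑' γ', S'.indicator (fun γ' => ENNReal.ofReal (x ^ γ'.vertexCount)) γ' =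
      ∑' γ' : S', ENNReal.ofReal (x ^ γ'.1.vertexCount) :=
    (tsum_subtype S' fun γ' => ENNReal.ofReal (x ^ γ'.vertexCount)).symm
  rw [hS']
  -- the `Ω`-walk behind an `S'`-walk
  have hex : ∀ γ' : S', ∃ γ ∈ S, γ.walk.support = γ'.1.walk.support := fun γ' => h γ'.1 γ'.2
  choose ι hιS hι using hex
  have hinj : Function.Injective ι := by
    intro γ₁ γ₂ h12
    apply Subtype.ext
    apply EmbDomainSAW.ext_support
    rw [← hι γ₁, ← hι γ₂, h12]
  calc ∑' γ' : S', ENNReal.ofReal (x ^ γ'.1.vertexCount)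
      = ∑' γ' : S', S.indicator (fun γ : EmbDomainSAW G emb Ω δ a b =>
            ENNReal.ofReal (x ^ γ.vertexCount)) (ι γ') := by
        refine tsum_congr fun γ' => ?_
        rw [Set.indicator_of_mem (hιS γ'), EmbDomainSAW.vertexCount_eq_of_support_eq (hι γ')]
    _ ≤ ∑' γ, S.indicator (fun γ : EmbDomainSAW G emb Ω δ a b =>
          ENNReal.ofReal (x ^ γ.vertexCount)) γ :=
        ENNReal.tsum_comp_le_tsum_of_injective hinj _

variable (G emb)

/-- **Half of the identity, no nesting needed**: the weight, in `Ω_δ`, of the confinement event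
"`γ` is (the support of) a walk of `Ω'_δ`" is at most the total weight of `Ω'_δ` (each confined
`Ω`-walk comes from a unique `Ω'`-walk with the same weight). [folklore] -/
theorem embWeight_setOf_exists_support_eq_le (Ω' Ω : Set ℂ) (δ x : ℝ) (a b : V) :
    embWeight G emb Ω δ x a b
        {γ | ∃ γ' : EmbDomainSAW G emb Ω' δ a b, γ'.walk.support = γ.walk.support} ≤
      embWeight G emb Ω' δ x a b Set.univ :=
  embWeight_le_embWeight_of_forall_exists_support_eq fun _ ⟨γ', hγ'⟩ => ⟨γ', Set.mem_univ _, hγ'⟩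

variable {G emb}

/-- **The other half, under nesting**: if every `Ω'_δ`-walk `a → b` is, with the same support, an
`Ω_δ`-walk, then for every set `E` of curve classes the weight of `{curve ∈ E}` among `Ω'`-walks
is at most its weight among `Ω`-walks (each `Ω'`-walk IS an `Ω`-walk with the same weight and the
same curve). [folklore] -/
theorem embWeight_setOf_curve_mem_le
    (hN : ∀ γ' : EmbDomainSAW G emb Ω' δ a b, ∃ γ : EmbDomainSAW G emb Ω δ a b,
      γ.walk.support = γ'.walk.support)
    (E : Set (CurveClass ℂ)) :
    embWeight G emb Ω' δ x a b {γ' | γ'.curve ∈ E} ≤ embWeight G emb Ω δ x a b {γ | γ.curve ∈ E} := by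
  refine embWeight_le_embWeight_of_forall_exists_support_eq fun γ' hγ' => ?_
  obtain ⟨γ, hγ⟩ := hN γ'
  refine ⟨γ, ?_, hγ⟩
  show γ.curve ∈ E
  rwa [EmbDomainSAW.curve_eq_of_support_eq hγ]

/-- **Restriction covariance of the SAW law, event form**: for any two events `S'` of `Ω'_δ` and
`S` of `Ω_δ` such that every `S'`-walk is, with the same support, an `S`-walk,
`embLaw Ω' S' · embLaw Ω {γ is an Ω'_δ-walk} ≤ embLaw Ω S` (all junk cases included).
With `Z = embWeight Ω univ`, `Z' = embWeight Ω' univ`: the left side is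
`Z'⁻¹ W'(S') · Z⁻¹ W(Conf) ≤ Z'⁻¹ W'(S') · Z⁻¹ Z' = (Z'⁻¹ Z') · Z⁻¹ W'(S') ≤ Z⁻¹ W'(S') ≤ Z⁻¹ W(S)`.
[cite: LawlerSchrammWerner2004SAW, §3] -/
theorem embLaw_mul_embLaw_le_of_forall_exists_support_eq {S' : Set (EmbDomainSAW G emb Ω' δ a b)}
    {S : Set (EmbDomainSAW G emb Ω δ a b)}
    (h : ∀ γ' ∈ S', ∃ γ ∈ S, γ.walk.support = γ'.walk.support) :
    embLaw G emb Ω' δ x a b S' *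
        embLaw G emb Ω δ x a b
          {γ | ∃ γ' : EmbDomainSAW G emb Ω' δ a b, γ'.walk.support = γ.walk.support} ≤
      embLaw G emb Ω δ x a b S := by
  rw [embLaw_apply_eq_inv_mul_embWeight, embLaw_apply_eq_inv_mul_embWeight,
    embLaw_apply_eq_inv_mul_embWeight]
  set Z := embWeight G emb Ω δ x a b Set.univ
  set Z' := embWeight G emb Ω' δ x a b Set.univ
  set WS' := embWeight G emb Ω' δ x a b S'
  set WS := embWeight G emb Ω δ x a b S
  set WC := embWeight G emb Ω δ x a b
    {γ | ∃ γ' : EmbDomainSAW G emb Ω' δ a b, γ'.walk.support = γ.walk.support}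
  have h1 : WC ≤ Z' := embWeight_setOf_exists_support_eq_le G emb Ω' Ω δ x a b
  have h2 : WS' ≤ WS := embWeight_le_embWeight_of_forall_exists_support_eq h
  calc Z'⁻¹ * WS' * (Z⁻¹ * WC) ≤ Z'⁻¹ * WS' * (Z⁻¹ * Z') := by gcongr
    _ = (Z'⁻¹ * Z') * (Z⁻¹ * WS') := by ring
    _ ≤ 1 * (Z⁻¹ * WS') := by gcongr; exact ENNReal.inv_mul_le_one Z'
    _ = Z⁻¹ * WS' := one_mul _
    _ ≤ Z⁻¹ * WS := by gcongr

/-- **Restriction covariance of the SAW law of an embedded graph** (Lawler–Schramm–Werner's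
restriction property, lattice form, as an inequality covering the junk cases): if every
`Ω'_δ`-walk `a → b` is, with the same support, an `Ω_δ`-walk, then for every set `E` of curve
classes `embLaw Ω' {curve ∈ E} · embLaw Ω {γ is an Ω'_δ-walk} ≤ embLaw Ω {curve ∈ E}`.
With `Z = embWeight Ω univ`, `Z' = embWeight Ω' univ`: the left side is
`Z'⁻¹ W'(E) · Z⁻¹ W(Conf) ≤ Z'⁻¹ W'(E) · Z⁻¹ Z' = (Z'⁻¹ Z') · Z⁻¹ W'(E) ≤ Z⁻¹ W'(E) ≤ Z⁻¹ W(E)`.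
[cite: LawlerSchrammWerner2004SAW, §3] -/
theorem embLaw_mul_embLaw_setOf_exists_support_eq_le
    (hN : ∀ γ' : EmbDomainSAW G emb Ω' δ a b, ∃ γ : EmbDomainSAW G emb Ω δ a b,
      γ.walk.support = γ'.walk.support)
    (E : Set (CurveClass ℂ)) :
    embLaw G emb Ω' δ x a b {γ' | γ'.curve ∈ E} *
        embLaw G emb Ω δ x a b
          {γ | ∃ γ' : EmbDomainSAW G emb Ω' δ a b, γ'.walk.support = γ.walk.support} ≤
      embLaw G emb Ω δ x a b {γ | γ.curve ∈ E} := by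
  refine embLaw_mul_embLaw_le_of_forall_exists_support_eq fun γ' hγ' => ?_
  obtain ⟨γ, hγ⟩ := hN γ'
  refine ⟨γ, ?_, hγ⟩
  show γ.curve ∈ E
  rwa [EmbDomainSAW.curve_eq_of_support_eq hγ]

/-- **Restriction covariance of the SAW law, polyline form** (the literal transposition of
`SAW.law_mul_law_setOf_exists_support_eq_le`): if every `Ω'_δ`-walk `a → b` is, with the same
support, an `Ω_δ`-walk, then for every set `E` of (parametrised) curves
`embLaw Ω' {polyline ∈ E} · embLaw Ω {γ is an Ω'_δ-walk} ≤ embLaw Ω {polyline ∈ E}`, the polyline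
being `⟨γ.walk.toCurve fun v => δ emb v⟩ : Curve ℂ`. [cite: LawlerSchrammWerner2004SAW, §3] -/
theorem embLaw_mul_embLaw_setOf_toCurve_mem_le
    (hN : ∀ γ' : EmbDomainSAW G emb Ω' δ a b, ∃ γ : EmbDomainSAW G emb Ω δ a b,
      γ.walk.support = γ'.walk.support)
    (E : Set (Curve ℂ)) :
    embLaw G emb Ω' δ x a b {γ' | (⟨γ'.walk.toCurve fun v => (δ : ℂ) * emb v⟩ : Curve ℂ) ∈ E} *
        embLaw G emb Ω δ x a b
          {γ | ∃ γ' : EmbDomainSAW G emb Ω' δ a b, γ'.walk.support = γ.walk.support} ≤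
      embLaw G emb Ω δ x a b {γ | (⟨γ.walk.toCurve fun v => (δ : ℂ) * emb v⟩ : Curve ℂ) ∈ E} := by
  refine embLaw_mul_embLaw_le_of_forall_exists_support_eq fun γ' hγ' => ?_
  obtain ⟨γ, hγ⟩ := hN γ'
  refine ⟨γ, ?_, hγ⟩
  show (⟨γ.walk.toCurve fun v => (δ : ℂ) * emb v⟩ : Curve ℂ) ∈ E
  rwa [EmbDomainSAW.toCurve_eq_of_support_eq hγ]

/-! ### The exact identity: confinement probability = ratio of partition functions -/

/-- **The other inequality for the confinement event, under nesting**: if every `Ω'_δ`-walk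
`a → b` is, with the same support, an `Ω_δ`-walk, then the total weight `Z' = embWeight Ω' univ`
of `Ω'_δ` is at most the weight, in `Ω_δ`, of the confinement event "`γ` is (the support of) a
walk of `Ω'_δ`" (each `Ω'`-walk IS a confined `Ω`-walk of the same weight, injectively).
[folklore] -/
theorem embWeight_univ_le_embWeight_setOf_exists_support_eq
    (hN : ∀ γ' : EmbDomainSAW G emb Ω' δ a b, ∃ γ : EmbDomainSAW G emb Ω δ a b,
      γ.walk.support = γ'.walk.support) :
    embWeight G emb Ω' δ x a b Set.univ ≤
      embWeight G emb Ω δ x a b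
        {γ | ∃ γ' : EmbDomainSAW G emb Ω' δ a b, γ'.walk.support = γ.walk.support} := by
  refine embWeight_le_embWeight_of_forall_exists_support_eq fun γ' _ => ?_
  obtain ⟨γ, hγ⟩ := hN γ'
  exact ⟨γ, ⟨γ', hγ.symm⟩, hγ⟩

/-- **Exact restriction identity, weight form**: under nesting, the weight in `Ω_δ` of the
confinement event "`γ` is (the support of) a walk of `Ω'_δ`" EQUALS the partition function
`Z' = embWeight Ω' univ` of the small discrete domain (the map `γ' ↦ its Ω-copy` is a
weight-preserving bijection onto the event; `embWeight_setOf_exists_support_eq_le` and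
`embWeight_univ_le_embWeight_setOf_exists_support_eq`). [cite: LawlerSchrammWerner2004SAW, §3] -/
theorem embWeight_setOf_exists_support_eq_eq
    (hN : ∀ γ' : EmbDomainSAW G emb Ω' δ a b, ∃ γ : EmbDomainSAW G emb Ω δ a b,
      γ.walk.support = γ'.walk.support) :
    embWeight G emb Ω δ x a b
        {γ | ∃ γ' : EmbDomainSAW G emb Ω' δ a b, γ'.walk.support = γ.walk.support} =
      embWeight G emb Ω' δ x a b Set.univ :=
  le_antisymm (embWeight_setOf_exists_support_eq_le G emb Ω' Ω δ x a b)
    (embWeight_univ_le_embWeight_setOf_exists_support_eq hN)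

/-- **Monotonicity of the partition function under nesting**: `Z' ≤ Z`, i.e.
`embWeight Ω' univ ≤ embWeight Ω univ`, when every `Ω'_δ`-walk `a → b` is, with the same support,
an `Ω_δ`-walk. [folklore] -/
theorem embWeight_univ_le_embWeight_univ
    (hN : ∀ γ' : EmbDomainSAW G emb Ω' δ a b, ∃ γ : EmbDomainSAW G emb Ω δ a b,
      γ.walk.support = γ'.walk.support) :
    embWeight G emb Ω' δ x a b Set.univ ≤ embWeight G emb Ω δ x a b Set.univ :=
  (embWeight_univ_le_embWeight_setOf_exists_support_eq hN).trans (measure_mono (Set.subset_univ _))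

/-- **Confinement probability = ratio of partition functions** (the exact restriction identity
of the SAW law, lattice form; companion to the inequality
`embLaw_mul_embLaw_setOf_exists_support_eq_le`): under nesting, the law in `Ω_δ` of the
confinement event "`γ` is (the support of) a walk of `Ω'_δ`" is `Z⁻¹ · Z'` with
`Z = embWeight Ω univ`, `Z' = embWeight Ω' univ` (all junk cases included: both sides are `0` if
`Z = 0`, as then `Z' ≤ Z = 0`, or if `Z = ∞`). [cite: LawlerSchrammWerner2004SAW, §3] -/
theorem embLaw_setOf_exists_support_eq_eq
    (hN : ∀ γ' : EmbDomainSAW G emb Ω' δ a b, ∃ γ : EmbDomainSAW G emb Ω δ a b,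
      γ.walk.support = γ'.walk.support) :
    embLaw G emb Ω δ x a b
        {γ | ∃ γ' : EmbDomainSAW G emb Ω' δ a b, γ'.walk.support = γ.walk.support} =
      (embWeight G emb Ω δ x a b Set.univ)⁻¹ * embWeight G emb Ω' δ x a b Set.univ := by
  rw [embLaw_apply_eq_inv_mul_embWeight, embWeight_setOf_exists_support_eq_eq hN]

/-- **Lower bounds on the confinement probability are lower bounds on the ratio of partition
functions**: under nesting and for a genuine partition function `0 < Z < ∞` of the big
discrete domain, `p ≤ embLaw Ω {γ is an Ω'_δ-walk} ↔ p · Z ≤ Z'`. [folklore] -/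
theorem le_embLaw_setOf_exists_support_eq_iff
    (hN : ∀ γ' : EmbDomainSAW G emb Ω' δ a b, ∃ γ : EmbDomainSAW G emb Ω δ a b,
      γ.walk.support = γ'.walk.support)
    (h0 : embWeight G emb Ω δ x a b Set.univ ≠ 0) (htop : embWeight G emb Ω δ x a b Set.univ ≠ ∞)
    (p : ℝ≥0∞) :
    p ≤ embLaw G emb Ω δ x a b
        {γ | ∃ γ' : EmbDomainSAW G emb Ω' δ a b, γ'.walk.support = γ.walk.support} ↔
      p * embWeight G emb Ω δ x a b Set.univ ≤ embWeight G emb Ω' δ x a b Set.univ := by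
  rw [embLaw_setOf_exists_support_eq_eq hN, mul_comm, ← div_eq_mul_inv,
    ENNReal.le_div_iff_mul_le (Or.inl h0) (Or.inl htop)]

end Embedded

/-! ### The hexagonal lattice -/

section Hex

variable {Ω' Ω : Set ℂ} {δ : ℝ} {a b : HexVertex}

/-- **Restriction covariance of the critical hexagonal SAW law `P_{x_c,δ}`**: if every
`Ω'_δ`-walk `a → b` of `δℍ` is, with the same support, an `Ω_δ`-walk, then for every set `E` of
curve classes `hexSAWLaw Ω' {curve ∈ E} · hexSAWLaw Ω {γ is an Ω'_δ-walk} ≤ hexSAWLaw Ω {curve ∈ E}`.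
[cite: LawlerSchrammWerner2004SAW, §3] -/
theorem hexSAWLaw_mul_hexSAWLaw_setOf_exists_support_eq_le
    (hN : ∀ γ' : HexDomainSAW Ω' δ a b, ∃ γ : HexDomainSAW Ω δ a b,
      γ.walk.support = γ'.walk.support)
    (E : Set (CurveClass ℂ)) :
    hexSAWLaw Ω' δ a b {γ' | γ'.curve ∈ E} *
        hexSAWLaw Ω δ a b {γ | ∃ γ' : HexDomainSAW Ω' δ a b, γ'.walk.support = γ.walk.support} ≤
      hexSAWLaw Ω δ a b {γ | γ.curve ∈ E} :=
  embLaw_mul_embLaw_setOf_exists_support_eq_le hN E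

/-- **Confinement probability = ratio of critical partition functions, hexagonal lattice**: under
nesting, `hexSAWLaw Ω {γ is an Ω'_δ-walk} = Z⁻¹ · Z'` with `Z = hexSAWWeight Ω univ`,
`Z' = hexSAWWeight Ω' univ`. [cite: LawlerSchrammWerner2004SAW, §3] -/
theorem hexSAWLaw_setOf_exists_support_eq_eq
    (hN : ∀ γ' : HexDomainSAW Ω' δ a b, ∃ γ : HexDomainSAW Ω δ a b,
      γ.walk.support = γ'.walk.support) :
    hexSAWLaw Ω δ a b {γ | ∃ γ' : HexDomainSAW Ω' δ a b, γ'.walk.support = γ.walk.support} =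
      (hexSAWWeight Ω δ a b Set.univ)⁻¹ * hexSAWWeight Ω' δ a b Set.univ :=
  embLaw_setOf_exists_support_eq_eq hN

end Hex

end Literature.Probability.RandomPlanarGeometry.SAW

end
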